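import Mathlib
import Summits.Ventures.HodgeRepro2.T5ValuedBallBasis
import Summits.Ventures.HodgeRepro2.T5CircleCharacterCount

/-!
# Characters of a `Valued` field on a ball are shifts of one non-trivial character — the
  finite-quotient half of (A1′) (Pontryagin self-duality of a local field)

`K` a field with `Valued K ℤᵐ⁰`, `B k := {x ∣ v x ≤ exp k}` (an additive subgroup), `ψ : AddChar K Circle`
of «conductor `c`»: trivial on `B c`, not trivial on `B (c+1)`.  Shifts: `ψ(t·)`.

* `forall_mulShift_eq_one_of_val_le` / `val_le_of_forall_mulShift_eq_one`: `ψ(t·)` is trivial on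
  `B m` IFF `v t ≤ exp (c − m)`;
* `relIndex_ball_eq_of_exists_val_eq`: scaling by an element of valuation `exp j` gives
  `[B (a+j) : B (b+j)] = [B a : B b]`;
* `exists_mem_ball_forall_eq_mulShift` (THE FINITE-QUOTIENT SELF-DUALITY): if the balls have finite
  index in each other and every valuation `exp j` is attained, then every character `χ` of `K`
  trivial on `B b` agrees on `B a` (`a ≥ b`) with a shift `ψ(t·)`, `v t ≤ exp (c − b)` — by counting:
  the shifts by `B (c−b)` modulo `B (c−a)` inject into the characters of `B a` trivial on `B b`, and
  both sides have `[B a : B b]` elements (`T5CircleCharacterCount`).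

Declaration per README §8(d): «uses an L-value-free non-vanishing device: NO».
-/

namespace Summit.Ventures.HodgeRepro2.T5BallCharacters

open WithZero T5ValuedBallBasis

variable {K : Type*} [Field K] [Valued K ℤᵐ⁰]

section Balls

/-- The ball `B k = {x ∣ v x ≤ exp k}` as an additive subgroup. -/
abbrev ball (k : ℤ) : AddSubgroup K := (Valued.v : Valuation K ℤᵐ⁰).leAddSubgroup (exp k)

/-- Membership in the ball `B k`. -/
theorem mem_ball_iff {k : ℤ} {x : K} : x ∈ ball (K := K) k ↔ Valued.v x ≤ exp k :=
  Valuation.mem_leAddSubgroup_iff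

/-- The balls increase with `k`. -/
theorem ball_mono {k l : ℤ} (h : k ≤ l) : ball (K := K) k ≤ ball l := fun x hx => by
  rw [mem_ball_iff] at hx ⊢
  exact le_trans hx (exp_le_exp.2 h)

/-- `v t ≤ exp j` and `x ∈ B k` ⇒ `t x ∈ B (j + k)`. -/
theorem mul_mem_ball {t x : K} {j k : ℤ} (ht : Valued.v t ≤ exp j) (hx : x ∈ ball (K := K) k) :
    t * x ∈ ball (j + k) := by
  rw [mem_ball_iff] at hx ⊢
  rw [map_mul, exp_add]
  exact mul_le_mul' ht hx

end Balls

section Shift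

variable (ψ : AddChar K Circle) {c : ℤ}

/-- `v t ≤ exp (c − m)` ⇒ `ψ(t·)` is trivial on `B m`. -/
theorem forall_mulShift_eq_one_of_val_le (hψ1 : ∀ x : K, Valued.v x ≤ exp c → ψ x = 1) {t : K}
    {m : ℤ} (ht : Valued.v t ≤ exp (c - m)) :
    ∀ x : K, Valued.v x ≤ exp m → ψ (t * x) = 1 := by
  intro x hx
  apply hψ1
  rw [map_mul]
  calc Valued.v t * Valued.v x ≤ exp (c - m) * exp m := mul_le_mul' ht hx
    _ = exp c := by rw [← exp_add]; ring_nf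

/-- `ψ(t·)` trivial on `B m` ⇒ `v t ≤ exp (c − m)` (uses the non-triviality of `ψ` on `B (c+1)`). -/
theorem val_le_of_forall_mulShift_eq_one (hψ2 : ∃ y : K, Valued.v y ≤ exp (c + 1) ∧ ψ y ≠ 1)
    {t : K} {m : ℤ} (h : ∀ x : K, Valued.v x ≤ exp m → ψ (t * x) = 1) :
    Valued.v t ≤ exp (c - m) := by
  by_contra hlt
  rw [not_le] at hlt
  -- `hlt : exp (c - m) < v t`, i.e. `exp (c - m + 1) ≤ v t`
  have hge : exp (c - m + 1) ≤ Valued.v t := by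
    by_contra h'
    rw [not_le, lt_exp_succ_iff_le_exp] at h'
    exact absurd h' (not_le.2 hlt)
  obtain ⟨y, hy, hy1⟩ := hψ2
  have ht0 : t ≠ 0 := by
    rintro rfl
    simp at hge
  apply hy1
  have hx : Valued.v (y / t) ≤ exp m := by
    rw [map_div₀]
    have hvt : 0 < Valued.v t := by
      have : Valued.v t ≠ 0 := by simpa using ht0
      exact zero_lt_iff.2 this
    rw [div_le_iff₀ hvt]
    calc Valued.v y ≤ exp (c + 1) := hy
      _ = exp m * exp (c - m + 1) := by rw [← exp_add]; ring_nf
      _ ≤ exp m * Valued.v t := by gcongr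
  have := h (y / t) hx
  rwa [mul_div_cancel₀ y ht0] at this

end Shift

section Index

/-- Scaling by `u` with `v u = exp j` maps `B k` onto `B (k + j)`. -/
theorem map_mulLeft_ball {u : K} {j : ℤ} (hu : Valued.v u = exp j) (k : ℤ) :
    (ball (K := K) k).map (AddMonoidHom.mulLeft u) = ball (k + j) := by
  have hu0 : u ≠ 0 := by
    rintro rfl
    rw [map_zero] at hu
    exact WithZero.exp_ne_zero hu.symm
  ext y
  constructor
  · rintro ⟨x, hx, rfl⟩
    rw [AddMonoidHom.coe_mulLeft, add_comm]
    exact mul_mem_ball hu.le hx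
  · intro hy
    refine ⟨u⁻¹ * y, ?_, ?_⟩
    · have hinv : Valued.v u⁻¹ ≤ exp (-j) := by rw [map_inv₀, hu, exp_neg]
      have := mul_mem_ball hinv hy
      have h2 : -j + (k + j) = k := by ring
      rwa [h2] at this
    · rw [AddMonoidHom.coe_mulLeft]
      exact mul_inv_cancel_left₀ hu0 y

/-- `[B (a + j) : B (b + j)] = [B a : B b]` when some `u` has `v u = exp j`. -/
theorem relIndex_ball_add {u : K} {j : ℤ} (hu : Valued.v u = exp j) (a b : ℤ) :
    (ball (K := K) (b + j)).relIndex (ball (a + j)) = (ball (K := K) b).relIndex (ball (K := K) a) := by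
  have hu0 : u ≠ 0 := by
    rintro rfl
    rw [map_zero] at hu
    exact WithZero.exp_ne_zero hu.symm
  have hker : (AddMonoidHom.mulLeft u : K →+ K).ker = ⊥ := by
    rw [AddMonoidHom.ker_eq_bot_iff, AddMonoidHom.coe_mulLeft]
    exact mul_right_injective₀ hu0
  rw [← map_mulLeft_ball hu b, ← map_mulLeft_ball hu a, AddSubgroup.relIndex_map_map, hker,
    sup_bot_eq, sup_bot_eq]

end Index

section Count

variable (ψ : AddChar K Circle)

/-- The character `ψ(t·)` of the ball `B a`, as a monoid hom on `Multiplicative (B a)`. -/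
noncomputable def shiftChar (a : ℤ) (t : K) : Multiplicative (ball (K := K) a) →* Circle :=
  AddChar.toMonoidHom ((ψ.mulShift t).compAddMonoidHom (ball a).subtype)

/-- `shiftChar ψ a t x = ψ (t x)`. -/
theorem shiftChar_apply (a : ℤ) (t : K) (x : Multiplicative (ball (K := K) a)) :
    shiftChar ψ a t x = ψ (t * ((Multiplicative.toAdd x : ↥(ball (K := K) a)) : K)) := by
  simp [shiftChar, AddChar.toMonoidHom_apply, AddChar.compAddMonoidHom_apply, AddChar.mulShift_apply]

/-- The shift map `t ↦ ψ(t·)|_{B a}` on `B d`, as a group hom into the character group of `B a`. -/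
noncomputable def shiftHom (a d : ℤ) :
    Multiplicative (ball (K := K) d) →* (Multiplicative (ball (K := K) a) →* Circle) :=
  MonoidHom.mk' (fun t => shiftChar ψ a ((Multiplicative.toAdd t : ↥(ball (K := K) d)) : K)) (by
    intro t t'
    refine MonoidHom.ext fun x => ?_
    rw [MonoidHom.mul_apply, shiftChar_apply, shiftChar_apply, shiftChar_apply, toAdd_mul,
      AddSubgroup.coe_add, add_mul, AddChar.map_add_eq_mul])

/-- `shiftHom ψ a d t x = ψ (t x)`. -/
theorem shiftHom_apply (a d : ℤ) (t : Multiplicative (ball (K := K) d))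
    (x : Multiplicative (ball (K := K) a)) :
    shiftHom ψ a d t x = ψ (((Multiplicative.toAdd t : ↥(ball (K := K) d)) : K) * ((Multiplicative.toAdd x : ↥(ball (K := K) a)) : K)) := by
  simp [shiftHom, shiftChar_apply]

variable {c : ℤ}

/-- The shifts by `B (c − b)` are trivial on `B b`. -/
theorem shiftHom_mem_ker_restrictHom (hψ1 : ∀ x : K, Valued.v x ≤ exp c → ψ x = 1) (a b : ℤ)
    (t : Multiplicative (ball (K := K) (c - b))) :
    shiftHom ψ a (c - b) t ∈
      (MonoidHom.restrictHom
        (AddSubgroup.toSubgroup ((ball (K := K) b).addSubgroupOf (ball a))) Circle).ker := by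
  rw [T5CircleCharacterCount.mem_ker_restrictHom_iff]
  intro y hy
  rw [shiftHom_apply]
  have hyb : ((Multiplicative.toAdd y : ↥(ball (K := K) a)) : K) ∈ ball b := hy
  exact forall_mulShift_eq_one_of_val_le ψ hψ1 (mem_ball_iff.1 (Multiplicative.toAdd t).2) _
    (mem_ball_iff.1 hyb)

/-- The kernel of the shift map on `B (c − b)` is `B (c − a)`. -/
theorem ker_shiftHom (hψ1 : ∀ x : K, Valued.v x ≤ exp c → ψ x = 1)
    (hψ2 : ∃ y : K, Valued.v y ≤ exp (c + 1) ∧ ψ y ≠ 1) (a b : ℤ) :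
    (shiftHom ψ a (c - b)).ker =
      AddSubgroup.toSubgroup ((ball (K := K) (c - a)).addSubgroupOf (ball (c - b))) := by
  ext t
  rw [MonoidHom.mem_ker]
  constructor
  · intro h
    show ((Multiplicative.toAdd t : ↥(ball (K := K) (c - b))) : K) ∈ ball (c - a)
    rw [mem_ball_iff]
    apply val_le_of_forall_mulShift_eq_one ψ hψ2
    intro x hx
    have := congrArg (fun f => f (Multiplicative.ofAdd (⟨x, mem_ball_iff.2 hx⟩ : ball (K := K) a))) h
    simpa [shiftHom_apply] using this
  · intro h
    have ht : ((Multiplicative.toAdd t : ↥(ball (K := K) (c - b))) : K) ∈ ball (c - a) := h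
    refine MonoidHom.ext fun x => ?_
    rw [shiftHom_apply, MonoidHom.one_apply]
    exact forall_mulShift_eq_one_of_val_le ψ hψ1 (mem_ball_iff.1 ht) _
      (mem_ball_iff.1 (Multiplicative.toAdd x).2)

end Count

section Main

variable (ψ : AddChar K Circle) {c : ℤ}

/-- THE FINITE-QUOTIENT SELF-DUALITY: `ψ` of conductor `c`, the balls of finite index in each other,
every valuation `exp j` attained; then a character `χ` trivial on `B b` agrees on `B a` (`a ≥ b`)
with a shift `ψ(t·)`, `v t ≤ exp (c − b)`. -/
theorem exists_val_le_forall_eq_mulShift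
    (hψ1 : ∀ x : K, Valued.v x ≤ exp c → ψ x = 1)
    (hψ2 : ∃ y : K, Valued.v y ≤ exp (c + 1) ∧ ψ y ≠ 1)
    (hfin : ∀ a b : ℤ, b ≤ a → (ball (K := K) b).relIndex (ball a) ≠ 0)
    (hval : ∀ j : ℤ, ∃ u : K, Valued.v u = exp j)
    {a b : ℤ} (hab : b ≤ a) (χ : AddChar K Circle) (hχ : ∀ x : K, Valued.v x ≤ exp b → χ x = 1) :
    ∃ t : K, Valued.v t ≤ exp (c - b) ∧ ∀ x : K, Valued.v x ≤ exp a → χ x = ψ (t * x) := by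
  set N : Subgroup (Multiplicative (ball (K := K) a)) :=
    AddSubgroup.toSubgroup ((ball (K := K) b).addSubgroupOf (ball a)) with hN
  set Φ := (MonoidHom.restrictHom N Circle).ker with hΦ
  have hNidx : N.index = (ball (K := K) b).relIndex (ball a) := AddSubgroup.index_toSubgroup _
  have hN0 : N.index ≠ 0 := by rw [hNidx]; exact hfin a b hab
  have hcardΦ : Nat.card Φ = (ball (K := K) b).relIndex (ball a) := by
    rw [hΦ, T5CircleCharacterCount.card_ker_restrictHom_circle N hN0, hNidx]
  set S := shiftHom ψ a (c - b) with hS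
  have hrange_le : S.range ≤ Φ := by
    rintro _ ⟨t, rfl⟩
    exact shiftHom_mem_ker_restrictHom ψ hψ1 a b t
  have hcard_range : Nat.card S.range = (ball (K := K) b).relIndex (ball a) := by
    rw [← Subgroup.index_ker, hS, ker_shiftHom ψ hψ1 hψ2 a b, AddSubgroup.index_toSubgroup]
    show (ball (K := K) (c - a)).relIndex (ball (c - b)) = _
    obtain ⟨u, hu⟩ := hval (c - a - b)
    have := relIndex_ball_add hu a b
    have e1 : b + (c - a - b) = c - a := by ring
    have e2 : a + (c - a - b) = c - b := by ring
    rw [e1, e2] at this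
    exact this
  haveI : Finite Φ := Nat.finite_of_card_ne_zero (by rw [hcardΦ]; exact hfin a b hab)
  have hrange : S.range = Φ :=
    Subgroup.eq_of_le_of_card_ge hrange_le (by rw [hcardΦ, hcard_range])
  set χa : Multiplicative (ball (K := K) a) →* Circle :=
    AddChar.toMonoidHom (χ.compAddMonoidHom (ball a).subtype) with hχa
  have hχa_mem : χa ∈ Φ := by
    rw [hΦ, T5CircleCharacterCount.mem_ker_restrictHom_iff]
    intro y hy
    have hyb : ((Multiplicative.toAdd y : ↥(ball (K := K) a)) : K) ∈ ball b := hy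
    rw [hχa, AddChar.toMonoidHom_apply, AddChar.compAddMonoidHom_apply, AddSubgroup.coe_subtype]
    exact hχ _ (mem_ball_iff.1 hyb)
  rw [← hrange] at hχa_mem
  obtain ⟨t, ht⟩ := hχa_mem
  refine ⟨((Multiplicative.toAdd t : ↥(ball (K := K) (c - b))) : K),
    mem_ball_iff.1 (Multiplicative.toAdd t).2, ?_⟩
  intro x hx
  have := congrArg (fun f => f (Multiplicative.ofAdd (⟨x, mem_ball_iff.2 hx⟩ : ball (K := K) a))) ht
  simp only [hS, shiftHom_apply, hχa, AddChar.toMonoidHom_apply, AddChar.compAddMonoidHom_apply,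
    AddSubgroup.coe_subtype, toAdd_ofAdd] at this
  exact this.symm

end Main

end Summit.Ventures.HodgeRepro2.T5BallCharacters
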